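import Mathlib
import HarnessLib
import Summits.HubbardSuperconductivity.HubbardSuperconductivity.Theorems.KLProgrammeKLRegimeEngineScaleOneDatumKlEng
import Summits.HubbardSuperconductivity.HubbardSuperconductivity.Theorems.KLProgrammeKLRegimeEngineTowerBlockZeroBaseWtKlEng

/-!
# Route `KLProgramme` — crux K3 ENGINE (stmt-HubbardSuperconductivity-20437 `KLRegimeEngineV17F2`), stub (b) v2, THE WEIGHTED HALF «(b)-WT4»:
# W13 — THE LEVEL-`0` WEIGHTED DATUM OF `𝒱_1[K]` AT `(F_0, rate j_r)`, EVERY RATE, EVERY ADMISSIBLE FRAME, AS A THEOREM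
# (cell gate-hubbard-kl, seat hubbard-kl-k3c3-p2 g17; the weighted twin of p3 g22's `exists_levelZeroDatum_klEng` (…ScaleOneDatumKlEng) — p3's proof verbatim up to
#  the bi-graded unit law, read for the rate-`j_r` WEIGHTED measured arrays `klTowerMeasWtAt … K 1 1 j_r (2p)` through `klWtPinnedSumAt_anti_rate`; credited)

WHY.  After W12 `kernelNormsWt4_all_klEng_closed` (p704715) the only model-dependent rows of stub (b)'s weighted clause that are not E1-structural are the
LEVEL-`0` WEIGHTED DATUM rows in kit currency: the unit law `klTowerMeasWtAt … (K_n) 1 1 j (2p) / klLevUnitF β M 0 p 0 ≤ A_b₀·λ_j^{p−1}·Q_b₀^p` (`p ≥ 3`) and the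
Chernoff/import rows of the array `W̄·Z̄^m·klTowerMeasWtAt … 1 1 j (2m)/klLevUnitF β M 0 m 0` at every rate `1 ≤ j ≤ n`.  p3 g22's F7 (`kernelNormsWtAt_one_of_doors`,
p697771) bounds every WEIGHTED pinned sum of `𝒱_1[K]` at `(F_0, rate 0)` by an explicit bi-graded budget `Nw`; the weights are ANTITONE in the rate
(`klWtPinnedSumAt_anti_rate`, `Λ_j` decreases), so the same budget bounds the rate-`j_r` sums for every `j_r`, and the measured array is their supremum
(`klTowerMeasWtAt_one_le_of_pins`).  Read through p3's bi-graded unit law (`baseRowsF_of_wgrid_bigraded` at `d := 1`) this gives, with the SAME `(A₁, P₁, T₁)` shapes as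
p3's plain datum package:
* **`exists_levelZeroDatumWt_klEng (P R)`** — `∃ A₁ P₁ T₁ > 0, ∃ c₀ > 0, ∃ U₀ > 0` (c-uniform doors; `U ≤ klEngU₀9 P R c`): in the regime, at every volume above
  `(klEngL₃, klEngM₃)`, for EVERY admissible frame `K` and EVERY rate `j_r`:
  (1) `klTowerMeasWtAt … K 1 1 j_r (2p) / klLevUnitF β M 0 p 0 ≤ (A₁ε_x/Klam²/B²)·(B·ε_j)^{p−1}·(P₁/ε_x²)^p` (`p ≥ 3`, every `B ≥ 1`, `j`);
  (2) `klTowerMeasWtAt … K 1 1 j_r 2 / klLevUnitF β M 0 1 0 ≤ T₁(|U|+c)/ε_x`; (3) `klTowerMeasWtAt … K 1 1 j_r 4 / klLevUnitF β M 0 2 0 ≤ A₁P₁²|U|/ε_x³`.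
Composition of landed theorems and real algebra; nothing about the model is asserted beyond them; nothing asserts (b), WT4, (ℓ), any stub, K3 or superconductivity.
References: BGM 2006 §2.7 (2.77)–(2.81), §2.8 (2.83), (2.93)–(2.98) [cite: BenfattoGiulianiMastropietro2006].
-/

noncomputable section

namespace Summit.HubbardSuperconductivity.HubbardSuperconductivity.Theorems.EngineV8

set_option linter.dupNamespace false -- summit = problem name (single-conjunct summit), D-0017

open Real Finset Complex Literature.MathematicalPhysics.QuantumLattice Literature.Probability.LatticeModels Literature.Probability.LatticeModels.BattleFederbush Literature.MathematicalPhysics.QuantumLattice.GrassmannAlgebra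
open Summit.HubbardSuperconductivity.HubbardSuperconductivity.Theorems.KLRegimeSplit Summit.HubbardSuperconductivity.HubbardSuperconductivity.Theorems.DispersionFlow
open Summit.HubbardSuperconductivity.HubbardSuperconductivity.Theorems.KLProgrammeLegKernels Summit.HubbardSuperconductivity.HubbardSuperconductivity.Theorems.ScaleZeroDecay
open scoped ComplexConjugate

variable {L M : ℕ}

set_option maxHeartbeats 400000 in -- the door bookkeeping + the bi-graded budget algebra (as in p3's `exists_levelZeroDatum_klEng`)
/-- **THE LEVEL-`0` WEIGHTED DATUM OF `𝒱_1[K]` AT `(F_0, rate j_r)`, EVERY RATE AND EVERY ADMISSIBLE FRAME** (see the module docstring): the unit law in degrees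
`2p ≥ 6` and the degree-`2`/`4` budgets of the rate-`j_r` weighted measured arrays, with p3's bi-graded constants `(A₁, P₁, T₁)`.
[cite: BenfattoGiulianiMastropietro2006, §2.7 (2.77)-(2.81), §2.8 (2.83), (2.93)-(2.98)] -/
theorem exists_levelZeroDatumWt_klEng (P : SplitConsts) (R : RenConsts) (hP : P.WF) (hR : R.WF2) :
    ∃ A₁ P₁ T₁ : ℝ, 0 < A₁ ∧ 0 < P₁ ∧ 0 < T₁ ∧ ∃ c₀ : ℝ, 0 < c₀ ∧ ∃ U₀ : ℝ, 0 < U₀ ∧ ∀ c : ℝ, 0 < c → c ≤ c₀ →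
      ∀ μ ∈ klWindowC, ∀ U : ℝ, 0 < U → U ≤ klEngU₀9 P R c → U ≤ U₀ → ∀ β : ℝ, klBetaMin ≤ β → β ≤ Real.exp (c / U ^ 2) →
        ∀ (L M : ℕ) [NeZero L] [NeZero M], klEngL₃ β U ≤ L → klEngM₃ β U L ≤ M →
          ∀ K : TrigPolyC4v, FrameOK R U (nScales β) μ K → ∀ jr : ℕ,
            (∀ (B : ℝ), 1 ≤ B → ∀ (j : ℕ) (p : ℕ), 3 ≤ p →
              klTowerMeasWtAt L M β U μ K 1 1 jr (2 * p) / klLevUnitF β M 0 p 0 ≤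
                (A₁ * imagTimeWeight β M / P.Klam ^ 2 / B ^ 2) * (B * epsCoupling P U j) ^ (p - 1) * (P₁ / imagTimeWeight β M ^ 2) ^ p) ∧
            klTowerMeasWtAt L M β U μ K 1 1 jr (2 * 1) / klLevUnitF β M 0 1 0 ≤ T₁ * (|U| + c) / imagTimeWeight β M ∧
            klTowerMeasWtAt L M β U μ K 1 1 jr (2 * 2) / klLevUnitF β M 0 2 0 ≤ A₁ * P₁ ^ 2 * |U| / imagTimeWeight β M ^ 3 := by
  obtain ⟨C_T, hCT0, hCT⟩ := exists_timeMomentConst_klAnisoFamily_zero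
  obtain ⟨D₁, hD₁, hbr⟩ := exists_abarOne_le
  have hRwf : R.WF := hR.wf
  have hG : ∀ j, 0 ≤ R.Gfr j := hRwf.2.2
  have hX0 : 0 ≤ klE4X0 := uvSpaceMomentConst_nonneg _ _ _
  have he1 : 1 ≤ Real.exp 1 := Real.one_le_exp (by norm_num)
  have he0 : 0 < Real.exp 1 := Real.exp_pos 1
  have h4 : 0 < Real.log 4 := Real.log_pos (by norm_num)
  have hKF := one_le_klE4KapF R
  have hK1 : 1 ≤ P.Klam := hP.1
  have hK0 : 0 < P.Klam := lt_of_lt_of_le one_pos hK1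
  -- the R-keyed bracket majorant `Ā := D₁·(1 + ΣGfr)⁴ ≥ 1`
  set g : ℝ := (1 + R.Gfr 0 + R.Gfr 1 + R.Gfr 2 + R.Gfr 3) ^ 4 with hg
  have hg1 : 1 ≤ g := by
    rw [hg]
    have : (1 : ℝ) ≤ 1 + R.Gfr 0 + R.Gfr 1 + R.Gfr 2 + R.Gfr 3 := by linarith [hG 0, hG 1, hG 2, hG 3]
    exact one_le_pow₀ this
  set Abar : ℝ := D₁ * g with hAbarD
  have hAbar1 : 1 ≤ Abar := one_le_mul_of_one_le_of_one_le hD₁ hg1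
  have hAbarpos : 0 < Abar := lt_of_lt_of_le one_pos hAbar1
  have hAbar0 : 0 ≤ Abar := hAbarpos.le
  set κ₁ : ℝ := Real.sqrt (2 * (7 + 6047)) + Real.sqrt 6047 with hκ₁
  have hκ₁1 : 1 ≤ κ₁ ^ 2 := by
    have h1 : (1 : ℝ) ≤ Real.sqrt (2 * (7 + 6047)) := by
      rw [show (1 : ℝ) = Real.sqrt 1 by simp]; exact Real.sqrt_le_sqrt (by norm_num)
    have h2 : 0 ≤ Real.sqrt 6047 := Real.sqrt_nonneg _
    have h3 : (1 : ℝ) ≤ κ₁ := by rw [hκ₁]; linarith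
    exact one_le_pow₀ h3
  have hκ₁pos : 0 < κ₁ := by
    rw [hκ₁]; exact add_pos_of_pos_of_nonneg (Real.sqrt_pos.2 (by norm_num)) (Real.sqrt_nonneg _)
  have hKFpos : 0 < klE4KapF R := lt_of_lt_of_le one_pos hKF
  have hMom1 : 0 < klE4Mom R + 1 := by have := klE4Mom_nonneg R; linarith
  set t : ℝ := 2 * klIsoT + C_T + 8 * (klE4X0 + 1) with ht
  have ht0 : 0 < t := by have := klIsoT_nonneg; rw [ht]; positivity
  -- the bi-graded constants of the budget
  set A₁ : ℝ := 4 * Real.exp 1 ^ 9 * κ₁ ^ 4 / (16 * Real.exp 1 ^ 9 * κ₁ ^ 2 * Abar) ^ 2 with hA₁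
  set P₁ : ℝ := 2 * (κ₁⁻¹) ^ 2 * t ^ 2 * (16 * Real.exp 1 ^ 9 * κ₁ ^ 2 * Abar) with hP₁
  have hA₁0 : 0 < A₁ := by rw [hA₁]; positivity
  have hP₁0 : 0 < P₁ := by rw [hP₁]; positivity
  set T₁ : ℝ := 2 * t ^ 2 * (Real.exp 1 ^ 5 * klE4KapF R + 4 * Real.exp 1 ^ 9 * κ₁ ^ 2 + Real.exp 1 ^ 5 * (2 / Real.log 4) * klE4Mom R) with hT₁
  have hMom0 : 0 ≤ klE4Mom R := klE4Mom_nonneg R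
  have hKF0 : 0 ≤ klE4KapF R := hKFpos.le
  have hT₁0 : 0 < T₁ := by rw [hT₁]; positivity
  refine ⟨A₁, P₁, T₁, hA₁0, hP₁0, hT₁0, ?_⟩
  -- the c-door
  set c₀ : ℝ := min (klEngC₃6 P R) (Real.log 4 / (128 * Real.exp 1 ^ 5 * Abar * (klE4Mom R + 1))) with hc₀
  refine ⟨c₀, lt_min (klEngC₃6_pos P R) (by positivity), 1 / (128 * Real.exp 1 ^ 9 * κ₁ ^ 2 * Abar * klE4KapF R), by positivity,
    fun c hc hcc₀ => ?_⟩
  have hc₆ : c ≤ klEngC₃6 P R := hcc₀.trans (min_le_left _ _)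
  have hcd' : c ≤ Real.log 4 / (128 * Real.exp 1 ^ 5 * Abar * (klE4Mom R + 1)) := hcc₀.trans (min_le_right _ _)
  have hcd : 128 * Real.exp 1 ^ 5 * Abar * (klE4Mom R + 1) * (c / Real.log 4) ≤ 1 := by
    have hden : 0 < 128 * Real.exp 1 ^ 5 * Abar * (klE4Mom R + 1) := by positivity
    rw [le_div_iff₀ hden] at hcd'
    rw [show 128 * Real.exp 1 ^ 5 * Abar * (klE4Mom R + 1) * (c / Real.log 4) =
      128 * Real.exp 1 ^ 5 * Abar * (klE4Mom R + 1) * c / Real.log 4 by ring, div_le_one h4]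
    linarith
  -- the U-door
  intro μ hμ U hU hU9 hUd' β hβ hβc L M _ _ hL hM K hK jr
  have hU₆ : U ≤ klEngU₀6 P R c := hU9.trans (klEngU₀9_le_klEngU₀6 P R c)
  have hUd : 128 * Real.exp 1 ^ 9 * κ₁ ^ 2 * Abar * klE4KapF R * U ≤ 1 := by
    have hden : 0 < 128 * Real.exp 1 ^ 9 * κ₁ ^ 2 * Abar * klE4KapF R := by positivity
    rw [le_div_iff₀ hden] at hUd'; linarith
  obtain ⟨hθ1, hθ2⟩ := thetaW_smallness_of_le (cl := c / Real.log 4) he1 hκ₁1 hAbar0 hKF hU (div_nonneg hc.le h4.le) hUd hcd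
  have hU₀3 : U ≤ klEngU₀3 P R c := hU₆.trans (klEngU₀6_le_klEngU₀3 P R c)
  have hU1 : |U| ≤ 1 := abs_le_one_of_le_klEngU₀3 hU hU₀3
  have hcD : c ≤ klE4C₃ R := hc₆.trans (klEngC₃6_le_klE4C₃ P R)
  have hNsc := nScales_succ_mul_sq_le (U := U) hc.le hβ hβc
  have hhalf := div_log_four_le_half_of_door hcD
  have hAbar := (hbr R U (nScales β) hRwf hU1 (hNsc.trans hhalf)).trans (le_of_eq hAbarD.symm)
  have hβ0 : 0 < β := beta_pos_of_klBetaMin_le hβ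
  have hε : 0 < imagTimeWeight β M := by
    unfold imagTimeWeight
    have : (0 : ℝ) < M := Nat.cast_pos.2 (Nat.pos_of_ne_zero (NeZero.ne M))
    positivity
  -- the budget: degree 2, the bi-graded closed form `A₁·P₁^p·|U|^{p−1}` in degrees `2p ≥ 4`, `0` elsewhere
  set kK : ℝ := klE4KapF R * |U| + 2 * (c / Real.log 4) * klE4Mom R with hkK
  have hkK0 : 0 ≤ kK := by rw [hkK]; have := klE4Mom_nonneg R; positivity
  set Nw : ℕ → ℝ := fun p => if p = 1 then 2 * t ^ 2 * (Real.exp 1 ^ 5 * kK + 4 * Real.exp 1 ^ 9 * κ₁ ^ 2 * |U|)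
    else if 2 ≤ p then A₁ * P₁ ^ p * |U| ^ (p - 1) else 0 with hNw
  have hNw0 : ∀ p, 0 ≤ Nw p := by
    intro p
    simp only [hNw]
    split_ifs
    · positivity
    · positivity
    · exact le_rfl
  set N : ℕ → ℝ := fun m => if Even m then Nw (m / 2) else 0 with hN
  have hNodd : ∀ m, Odd m → 0 ≤ N m := fun m hm => by
    simp only [hN, Nat.not_even_iff_odd.2 hm, if_false]; exact le_rfl
  have hNeven : ∀ p, N (2 * p) = Nw p := fun p => by
    simp only [hN, even_two_mul, if_true, Nat.mul_div_cancel_left p two_pos]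
  have hN2 : 2 * (2 * klIsoT + C_T + 8 * (klE4X0 + 1)) ^ 2 * (Real.exp 1 ^ 5 * (klE4KapF R * |U| + 2 * (c / Real.log 4) * klE4Mom R) +
      4 * Real.exp 1 ^ 9 * (Real.sqrt (2 * (7 + 6047)) + Real.sqrt 6047) ^ 2 * |U|) ≤ N 2 := by
    have h21 : N 2 = Nw 1 := hNeven 1
    have hNw1 : Nw 1 = 2 * t ^ 2 * (Real.exp 1 ^ 5 * kK + 4 * Real.exp 1 ^ 9 * κ₁ ^ 2 * |U|) := by simp [hNw]
    rw [h21, hNw1, ht, hkK, hκ₁]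
  -- the literal budget of degree `2p ≥ 4` IS `A₁·P₁^p·|U|^{p−1}`
  have hlit : ∀ p, 2 ≤ p → 2 ^ p * (4 * Real.exp 1 ^ 9 * (Real.sqrt (2 * (7 + 6047)) + Real.sqrt 6047) ^ 4 *
      ((Real.sqrt (2 * (7 + 6047)) + Real.sqrt 6047))⁻¹ ^ (2 * p) * (2 * klIsoT + C_T + 8 * (klE4X0 + 1)) ^ (2 * p) *
        (16 * Real.exp 1 ^ 9 * (Real.sqrt (2 * (7 + 6047)) + Real.sqrt 6047) ^ 2 * Abar * |U|) ^ (p - 2) * |U|) = A₁ * P₁ ^ p * |U| ^ (p - 1) := by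
    intro p hp
    obtain ⟨p', rfl⟩ : ∃ p', p = p' + 2 := ⟨p - 2, by omega⟩
    rw [← hκ₁, ← ht, Nat.add_sub_cancel, show p' + 2 - 1 = p' + 1 by omega]
    set W : ℝ := 16 * Real.exp 1 ^ 9 * κ₁ ^ 2 * Abar with hWdef
    have hW0 : 0 < W := by rw [hWdef]; positivity
    have hAW2 : A₁ * W ^ 2 = 4 * Real.exp 1 ^ 9 * κ₁ ^ 4 := by rw [hA₁]; field_simp
    rw [hP₁, mul_pow (2 * κ₁⁻¹ ^ 2 * t ^ 2) W (p' + 2), mul_pow (2 * κ₁⁻¹ ^ 2) (t ^ 2) (p' + 2), mul_pow (2 : ℝ) (κ₁⁻¹ ^ 2) (p' + 2),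
      ← pow_mul κ₁⁻¹ 2 (p' + 2), ← pow_mul t 2 (p' + 2), mul_pow W |U| p', pow_succ |U| p', pow_add W p' 2]
    clear_value W A₁ P₁ κ₁ t Abar kK Nw N
    generalize (2 : ℝ) ^ (p' + 2) = n2
    generalize κ₁⁻¹ ^ (2 * (p' + 2)) = a
    generalize t ^ (2 * (p' + 2)) = b
    generalize W ^ p' = w
    generalize |U| ^ p' = u
    linear_combination (-(n2 * a * b * w * u * |U|)) * hAW2
  have hNp : ∀ p, 2 ≤ p → 2 ^ p * (4 * Real.exp 1 ^ 9 * (Real.sqrt (2 * (7 + 6047)) + Real.sqrt 6047) ^ 4 *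
      ((Real.sqrt (2 * (7 + 6047)) + Real.sqrt 6047))⁻¹ ^ (2 * p) * (2 * klIsoT + C_T + 8 * (klE4X0 + 1)) ^ (2 * p) *
        (16 * Real.exp 1 ^ 9 * (Real.sqrt (2 * (7 + 6047)) + Real.sqrt 6047) ^ 2 * Abar * |U|) ^ (p - 2) * |U|) ≤ N (2 * p) := by
    intro p hp
    rw [hlit p hp, hNeven p]
    simp only [hNw, show p ≠ 1 by omega, if_false, hp, if_true]
    exact le_rfl
  -- F7 under the doors: every weighted pinned sum of `𝒱_1[K]` at `(F_0, rate 0)` is within the budget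
  have hfull := kernelNormsWtAt_one_of_doors hCT0 hCT P R c hP hR hc hc₆ μ hμ U hU hU₆ β hβ hβc K hK L M hL hM hAbar hθ1 hθ2 N hNodd hN2 hNp
  have hgrid : ∀ p, 1 ≤ p → ∀ (q : Fin (2 * p)) (w : SpaceTimeIdx L M × SectorLeg (sectorCount (1 - 1))),
      klWtPinnedSumAt L M β μ K (1 - 1) 0 (2 * p) (klTowerInput L M β U μ K 1 1) q w ≤ Nw p := by
    intro p _ q w
    rw [← hNeven p]
    unfold klTowerInput
    exact hfull (2 * p) q w
  -- the bi-graded reading with `Ag := A₁·ε_x`, `Pg := P₁/ε_x²`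
  have hbi : ∀ p, 3 ≤ p → Nw p ≤ imagTimeWeight β M ^ (2 * p - 1) * (A₁ * imagTimeWeight β M) * (P₁ / imagTimeWeight β M ^ 2) ^ p * |U| ^ (p - 1) := by
    intro p hp
    have hval : Nw p = A₁ * P₁ ^ p * |U| ^ (p - 1) := by
      simp only [hNw, show p ≠ 1 by omega, if_false, show 2 ≤ p by omega, if_true]
    rw [hval]
    apply le_of_eq
    obtain ⟨p', rfl⟩ : ∃ p', p = p' + 1 := ⟨p - 1, by omega⟩
    have hεne : imagTimeWeight β M ≠ 0 := hε.ne'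
    rw [show 2 * (p' + 1) - 1 = 2 * p' + 1 by omega, div_pow, ← pow_mul, Nat.add_sub_cancel]
    clear_value A₁ P₁ κ₁ t Abar kK Nw N
    generalize imagTimeWeight β M = ε at hεne ⊢
    generalize |U| ^ p' = u
    generalize P₁ ^ (p' + 1) = q
    field_simp
    ring
  -- the floor unit at `J = 0`
  have hu0 : ∀ (t' : Fin 5) (p : ℕ), klLevUnitF β M t' p (1 - 1) = imagTimeWeight β M ^ (2 * p - 1) := fun t' p => by simp [klLevUnitF]
  have hU0 : 0 ≤ |U| := abs_nonneg U
  -- the unit law at every `(B, j)` from `baseRowsF_of_wgrid_bigraded`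
  have hlawBj : ∀ (B : ℝ), 1 ≤ B → ∀ (j : ℕ) (t' : Fin 5) (p : ℕ), 3 ≤ p → (fun (_ : Fin 5) (p : ℕ) => Nw p) t' p / klLevUnitF β M t' p (1 - 1) ≤
      (A₁ * imagTimeWeight β M / P.Klam ^ 2 / B ^ 2) * (B * epsCoupling P U j) ^ (p - 1) * (P₁ / imagTimeWeight β M ^ 2) ^ p := by
    intro B hB j t' p hp
    have hB0 : 0 < B := lt_of_lt_of_le one_pos hB
    have hBK : 1 ≤ B * P.Klam := one_le_mul_of_one_le_of_one_le hB hK1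
    have hle : B * P.Klam * |U| ≤ B * epsCoupling P U j := by
      unfold epsCoupling
      have h1 : |U| ≤ |U| + U ^ 2 * (j : ℝ) := le_add_of_nonneg_right (by positivity)
      calc B * P.Klam * |U| = B * (P.Klam * |U|) := by ring
        _ ≤ B * (P.Klam * (|U| + U ^ 2 * (j : ℝ))) := mul_le_mul_of_nonneg_left (mul_le_mul_of_nonneg_left h1 hK0.le) hB0.le
    obtain ⟨-, -, hlawb⟩ := baseRowsF_of_wgrid_bigraded (L := L) (M := M) hβ0 U μ K 1 0 Nw hNw0 hgrid (by positivity : 0 ≤ A₁ * imagTimeWeight β M)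
      (by positivity : 0 ≤ P₁ / imagTimeWeight β M ^ 2) hbi hK0 hBK hle
    have h := hlawb t' p hp
    simp only [Nat.sub_self, Nat.mul_zero, pow_zero, one_mul, div_one] at h
    exact h
  -- every rate-`j_r` weighted pinned sum of `𝒱_1[K]` at `F_0` is below its rate-`0` value (antitone in the rate), hence the measured array is within the budget
  have hmeas : ∀ p, 1 ≤ p → klTowerMeasWtAt L M β U μ K 1 1 jr (2 * p) ≤ Nw p := fun p hp =>
    klTowerMeasWtAt_one_le_of_pins U μ K 1 jr (2 * p) (hNw0 p) fun q w => by
      have h := hgrid p hp q w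
      unfold klTowerInput at h
      exact (klWtPinnedSumAt_anti_rate hβ0.le μ K (1 - 1) (Nat.zero_le jr) (2 * p) _ q w).trans h
  have hu1 : klLevUnitF β M 0 1 0 = imagTimeWeight β M := by rw [show (0 : ℕ) = 1 - 1 from rfl, hu0 0 1]; norm_num
  have hu2 : klLevUnitF β M 0 2 0 = imagTimeWeight β M ^ 3 := by rw [show (0 : ℕ) = 1 - 1 from rfl, hu0 0 2]
  refine ⟨fun B hB j p hp => ?_, ?_, ?_⟩
  · -- `p ≥ 3`: the bi-graded unit law
    have h := hlawBj B hB j 0 p hp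
    simp only [Nat.sub_self] at h
    exact (div_le_div_of_nonneg_right (hmeas p (by omega)) (klLevUnitF_pos hβ0 0 p 0).le).trans h
  · -- `m = 1`: the degree-2 budget `Nw 1 ≤ T₁·(|U| + c)`
    have hNw1 : Nw 1 = 2 * t ^ 2 * (Real.exp 1 ^ 5 * kK + 4 * Real.exp 1 ^ 9 * κ₁ ^ 2 * |U|) := by simp [hNw]
    rw [hu1]
    refine div_le_div_of_nonneg_right ((hmeas 1 le_rfl).trans ?_) hε.le
    rw [hNw1]
    have hkey : Real.exp 1 ^ 5 * kK + 4 * Real.exp 1 ^ 9 * κ₁ ^ 2 * |U| ≤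
        (Real.exp 1 ^ 5 * klE4KapF R + 4 * Real.exp 1 ^ 9 * κ₁ ^ 2 + Real.exp 1 ^ 5 * (2 / Real.log 4) * klE4Mom R) * (|U| + c) := by
      have h1 : 0 ≤ (Real.exp 1 ^ 5 * klE4KapF R + 4 * Real.exp 1 ^ 9 * κ₁ ^ 2) * c := by positivity
      have h2 : 0 ≤ Real.exp 1 ^ 5 * (2 / Real.log 4) * klE4Mom R * |U| := by positivity
      have heq : (Real.exp 1 ^ 5 * klE4KapF R + 4 * Real.exp 1 ^ 9 * κ₁ ^ 2 + Real.exp 1 ^ 5 * (2 / Real.log 4) * klE4Mom R) * (|U| + c) =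
          Real.exp 1 ^ 5 * kK + 4 * Real.exp 1 ^ 9 * κ₁ ^ 2 * |U| +
            ((Real.exp 1 ^ 5 * klE4KapF R + 4 * Real.exp 1 ^ 9 * κ₁ ^ 2) * c + Real.exp 1 ^ 5 * (2 / Real.log 4) * klE4Mom R * |U|) := by
        rw [hkK]; ring
      rw [heq]; linarith
    calc 2 * t ^ 2 * (Real.exp 1 ^ 5 * kK + 4 * Real.exp 1 ^ 9 * κ₁ ^ 2 * |U|)
        ≤ 2 * t ^ 2 * ((Real.exp 1 ^ 5 * klE4KapF R + 4 * Real.exp 1 ^ 9 * κ₁ ^ 2 + Real.exp 1 ^ 5 * (2 / Real.log 4) * klE4Mom R) * (|U| + c)) :=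
          mul_le_mul_of_nonneg_left hkey (by positivity)
      _ = T₁ * (|U| + c) := by rw [hT₁]; ring
  · -- `m = 2`: the degree-4 budget `Nw 2 = A₁P₁²|U|`
    have hNw2 : Nw 2 = A₁ * P₁ ^ 2 * |U| ^ (2 - 1) := by simp [hNw]
    rw [hu2]
    refine div_le_div_of_nonneg_right ((hmeas 2 (by norm_num)).trans (le_of_eq ?_)) (by positivity)
    rw [hNw2, show 2 - 1 = 1 from rfl, pow_one]

end Summit.HubbardSuperconductivity.HubbardSuperconductivity.Theorems.EngineV8

end
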